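import Summits.MatrixMultiplication.MatrixMultiplication.Theorems.ObstructionDescentUniversalOccurrenceHalfSquare
import Summits.MatrixMultiplication.MatrixMultiplication.Theorems.ObstructionDescentUniversalOccurrenceFour
import Summits.MatrixMultiplication.MatrixMultiplication.Theorems.ObstructionDescentUniversalOccurrenceGenerators

set_option linter.dupNamespace false
set_option autoImplicit false

/-!
# Obstruction descent — universal occurrence IS Kronecker-semigroup swallowing: `UOCC(m,N) ⟺ K(N,N,N) ⊆ S(⟨m⟩)`
# (decomp-mm · lens 3 · gen 32, sixth kernel, def-free)

`route-MatrixMultiplication-ObstructionDescent`, crux `NoOccurrenceObstruction` (`P_O`, stmt 29040); NODE-g32 §1/§3.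

The universal-occurrence node `UOCC(m,N)` («every partition triple occurring in a tensor power of ANY complex tensor of format `≤ N`
occurs in the same power of the unit tensor `⟨m⟩`») is rewritten WITHOUT TENSORS ON THE LEFT: by the tree's two halves of
Bürgisser–Ikenmeyer's `S(w) ⊆ K(m)`, with equality for generic `w` — `kroneckerCoeff_pos_of_isotypicSum₁₂₃_kroneckerPow_ne_zero` (an occurring
triple has positive Kronecker coefficient) and `exists_occurs_of_kroneckerCoeff_pos` (a triple with positive Kronecker coefficient and `≤ N` parts
occurs for SOME tensor of format `N`) — it is EQUIVALENT (`uocc_iff_kroneckerSemigroup_le`) to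

  `KSW(m,N)`: every triple `λ ⊢ d` with at most `N` parts in each partition and `g(λ⁰,λ¹,λ²) > 0` occurs in `⟨m⟩^{⊗d}`,

i.e. to the containment `K(N,N,N) ⊆ S(⟨m⟩)` of the KRONECKER SEMIGROUP of format `N` in the semigroup of the unit tensor `⟨m⟩` — a statement about
Kronecker coefficients and ONE explicit family of tensors.  Consequently (`noOccurrenceObstruction_of_kroneckerSemigroup_threshold`):
**if for every `δ > 0` the Kronecker semigroup `K(N,N,N)` is swallowed by `S(⟨m⟩)` whenever `m ≥ N^{1+δ}` and `N` is large, then `P_O` holds** —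
matrix multiplication has left the statement entirely.  The instrument `u(N)` of NODE-g32 §3 is thus `min {m : K(N,N,N) ⊆ S(⟨m⟩)}`, the
unit-tensor rank that realises the whole Kronecker semigroup of format `N`; its tree rows transcribe: `K(N,N,N) ⊆ S(⟨m⟩)` for `m ≥ ⌈N²/2⌉`
(`kroneckerSemigroup_le_of_halfSquare_le`), `K(4,4,4) ⊆ S(⟨7⟩)` and `K(4,4,4) ⊄ S(⟨5⟩)` (`kroneckerSemigroup_four_row`), `K(n²) ⊄ S(⟨n²+1⟩)`
(`not_kroneckerSemigroup_le_of_le_sq_add_one`).  At the level of normalised closures (moment polytopes) the swallowing holds much earlier —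
`Δ(⟨4⟩) = Kron(4,4,4)` already in format `4` (van den Berg et al. 2025, PROVED tree theorem `vandenBergEtAl2025_unitTensor_four_polytope_maximal_holds`;
here `kroneckerSemigroup_four_saturated`) although `K(4,4,4) ⊄ S(⟨5⟩)` — so `u(N) − N` measures exactly the semigroup-versus-saturation gap of
Bürgisser–Ikenmeyer's Problem 8.3 for unit tensors.
No proposition is defined; no `def`; sorry-free; standard axioms.  Nothing here proves `ω = 2`.
[cite: BurgisserIkenmeyer2011, §3.1–3.2, Lemma 3.2, (10.3), Problem 8.3] [cite: vandenBergChristandlLysikovNieuwboerWalterZuiddam2025, §1]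
-/

noncomputable section

open scoped BigOperators

namespace Summit.MatrixMultiplication.MatrixMultiplication.Theorems.ObstructionCalculus

open Literature.Computability.AlgebraicComplexity (kroneckerPow isotypicSum₁ isotypicSum₂ isotypicSum₃ unitTensor matMulTensor
  exists_occurs_of_kroneckerCoeff_pos kroneckerCoeff_pos_of_isotypicSum₁₂₃_kroneckerPow_ne_zero
  card_parts_le_of_isotypicSum₁₂₃_kroneckerPow_ne_zero vandenBergEtAl2025_unitTensor_four_polytope_maximal_holds)
open Literature.NumberTheory.DiophantineGeometry (kroneckerCoeff)
open Summit.MatrixMultiplication.MatrixMultiplication.Theses.ObstructionDescent (NoOccurrenceObstruction)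

/-! ## §1  The equivalence -/

/-- **`UOCC(m,N) ⟺ K(N,N,N) ⊆ S(⟨m⟩)`.**  Universal occurrence at `(m,N)` — every triple occurring for any complex tensor on an index type of
cardinality `≤ N` occurs for `⟨m⟩` — is equivalent to: every partition triple of any degree `d` with at most `N` parts in each partition and
positive Kronecker coefficient occurs in `⟨m⟩^{⊗d}`.  (`→`: a positive Kronecker coefficient is witnessed by an occurring triple of some tensor
of format `N`, `exists_occurs_of_kroneckerCoeff_pos`; `←`: an occurring triple has positive Kronecker coefficient and at most `card` parts,
`kroneckerCoeff_pos_of_isotypicSum₁₂₃_kroneckerPow_ne_zero`, `card_parts_le_of_isotypicSum₁₂₃_kroneckerPow_ne_zero`.)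
[cite: BurgisserIkenmeyer2011, §3.2, Lemma 3.2 and (10.3)] -/
theorem uocc_iff_kroneckerSemigroup_le {m N : ℕ} :
    (∀ {ι : Type} [Fintype ι], Fintype.card ι ≤ N → ∀ (s : ι → ι → ι → ℂ) (d : ℕ)
      (lam : Fin 3 → Nat.Partition d),
      isotypicSum₁ (lam 0) (isotypicSum₂ (lam 1) (isotypicSum₃ (lam 2) (kroneckerPow s d))) ≠ 0 →
      isotypicSum₁ (lam 0) (isotypicSum₂ (lam 1) (isotypicSum₃ (lam 2) (kroneckerPow (unitTensor ℂ m) d))) ≠ 0) ↔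
    (∀ (d : ℕ) (lam : Fin 3 → Nat.Partition d), (∀ j, (lam j).parts.card ≤ N) →
      0 < kroneckerCoeff ℂ (lam 0) (lam 1) (lam 2) →
      isotypicSum₁ (lam 0) (isotypicSum₂ (lam 1) (isotypicSum₃ (lam 2) (kroneckerPow (unitTensor ℂ m) d))) ≠ 0) := by
  classical
  refine ⟨fun hU d lam hcard hg => ?_, fun hK ι _ hι s d lam hocc => ?_⟩
  · obtain ⟨s, hs⟩ := exists_occurs_of_kroneckerCoeff_pos hcard hg
    exact hU (by simp) s d lam hs
  · have hc := card_parts_le_of_isotypicSum₁₂₃_kroneckerPow_ne_zero hocc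
    have h0 := hc.1.trans hι
    have h1 := hc.2.1.trans hι
    have h2 := hc.2.2.trans hι
    refine hK d lam (fun j => ?_) (kroneckerCoeff_pos_of_isotypicSum₁₂₃_kroneckerPow_ne_zero hocc)
    fin_cases j <;> assumption

/-! ## §2  `P_O` from Kronecker-semigroup swallowing -/

/-- **`P_O` from Kronecker swallowing along the matrix-multiplication formats.**  If for every `τ > 2` and all large `n` every partition triple
with at most `n²` parts and positive Kronecker coefficient occurs in the tensor powers of `⟨max(n², ⌈n^τ⌉)⟩` (`K(n²,n²,n²) ⊆ S(⟨n^τ⟩)`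
eventually), then `NoOccurrenceObstruction`.  (`uocc_iff_kroneckerSemigroup_le` + `noOccurrenceObstruction_of_uocc_family`.)
[cite: BurgisserIkenmeyer2011, §3.2, Lemma 3.2] -/
theorem noOccurrenceObstruction_of_kroneckerSemigroup_family
    (hK : ∀ τ : ℝ, 2 < τ → ∃ n₀ : ℕ, ∀ n : ℕ, n₀ ≤ n →
      ∀ (d : ℕ) (lam : Fin 3 → Nat.Partition d), (∀ j, (lam j).parts.card ≤ n * n) →
        0 < kroneckerCoeff ℂ (lam 0) (lam 1) (lam 2) →
        isotypicSum₁ (lam 0) (isotypicSum₂ (lam 1) (isotypicSum₃ (lam 2)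
          (kroneckerPow (unitTensor ℂ (max (n * n) ⌈(n : ℝ) ^ τ⌉₊)) d))) ≠ 0) :
    NoOccurrenceObstruction := by
  refine noOccurrenceObstruction_of_uocc_family fun τ hτ => ?_
  obtain ⟨n₀, hn₀⟩ := hK τ hτ
  exact ⟨n₀, fun n hn => uocc_iff_kroneckerSemigroup_le.2 (hn₀ n hn)⟩

/-- **`P_O` from Kronecker swallowing at rank `N^{1+δ}`** (all formats `N`, the instrument form): if for every `δ > 0` there is `N₀` such that
`K(N,N,N) ⊆ S(⟨m⟩)` whenever `N ≥ N₀` and `m ≥ N^{1+δ}` — every triple with at most `N` parts and positive Kronecker coefficient occurs in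
the powers of `⟨m⟩` — then `NoOccurrenceObstruction`.  Matrix multiplication does not appear in the hypothesis.
(`uocc_iff_kroneckerSemigroup_le` + `noOccurrenceObstruction_of_uocc_threshold`.) [cite: BurgisserIkenmeyer2011, §3.2, Problem 8.3] -/
theorem noOccurrenceObstruction_of_kroneckerSemigroup_threshold
    (hK : ∀ δ : ℝ, 0 < δ → ∃ N₀ : ℕ, ∀ N m : ℕ, N₀ ≤ N → (N : ℝ) ^ (1 + δ) ≤ (m : ℝ) →
      ∀ (d : ℕ) (lam : Fin 3 → Nat.Partition d), (∀ j, (lam j).parts.card ≤ N) →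
        0 < kroneckerCoeff ℂ (lam 0) (lam 1) (lam 2) →
        isotypicSum₁ (lam 0) (isotypicSum₂ (lam 1) (isotypicSum₃ (lam 2) (kroneckerPow (unitTensor ℂ m) d))) ≠ 0) :
    NoOccurrenceObstruction := by
  refine noOccurrenceObstruction_of_uocc_threshold fun δ hδ => ?_
  obtain ⟨N₀, hN₀⟩ := hK δ hδ
  exact ⟨N₀, fun N m hN hm => uocc_iff_kroneckerSemigroup_le.2 (hN₀ N m hN hm)⟩

/-! ## §3  The tree's rows of the threshold, transcribed to the Kronecker semigroup -/

/-- **`K(N,N,N) ⊆ S(⟨m⟩)` for `m ≥ ⌈N/2⌉² + ⌊N/2⌋² = ⌈N²/2⌉`** (`N ≥ 2`): every partition triple with at most `N` parts and positive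
Kronecker coefficient occurs in the powers of the unit tensor of rank `⌈N²/2⌉` (the covering-code certificate `uocc_of_halfSquare_le`).
[cite: BurgisserIkenmeyer2011, §3.2] [cite: LandsbergGCT2017, §4.7.1] -/
theorem kroneckerSemigroup_le_of_halfSquare_le {m N : ℕ} (h2 : 2 ≤ N) (hm : ((N + 1) / 2) ^ 2 + (N / 2) ^ 2 ≤ m)
    {d : ℕ} (lam : Fin 3 → Nat.Partition d) (hcard : ∀ j, (lam j).parts.card ≤ N)
    (hg : 0 < kroneckerCoeff ℂ (lam 0) (lam 1) (lam 2)) :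
    isotypicSum₁ (lam 0) (isotypicSum₂ (lam 1) (isotypicSum₃ (lam 2) (kroneckerPow (unitTensor ℂ m) d))) ≠ 0 :=
  uocc_iff_kroneckerSemigroup_le.1 (uocc_of_halfSquare_le h2 hm) d lam hcard hg

/-- **The format-`4` row: `K(4,4,4) ⊄ S(⟨m⟩)` for `m ≤ 5` and `K(4,4,4) ⊆ S(⟨m⟩)` for `m ≥ 7`** (Bürgisser–Ikenmeyer's occurrence obstruction
`λ₂ ⊢ 8` resp. Lickteig's typical rank `7` of `4×4×4`; `uocc_four_row`).  Whether `K(4,4,4) ⊆ S(⟨6⟩)` is open (NODE-g32 §3).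
[cite: BurgisserIkenmeyer2011, Lemma 6.1] [cite: Lickteig1985, p. 95] -/
theorem kroneckerSemigroup_four_row {m : ℕ} :
    (m ≤ 5 → ¬ ∀ (d : ℕ) (lam : Fin 3 → Nat.Partition d), (∀ j, (lam j).parts.card ≤ 4) →
      0 < kroneckerCoeff ℂ (lam 0) (lam 1) (lam 2) →
      isotypicSum₁ (lam 0) (isotypicSum₂ (lam 1) (isotypicSum₃ (lam 2) (kroneckerPow (unitTensor ℂ m) d))) ≠ 0) ∧
    (7 ≤ m → ∀ (d : ℕ) (lam : Fin 3 → Nat.Partition d), (∀ j, (lam j).parts.card ≤ 4) →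
      0 < kroneckerCoeff ℂ (lam 0) (lam 1) (lam 2) →
      isotypicSum₁ (lam 0) (isotypicSum₂ (lam 1) (isotypicSum₃ (lam 2) (kroneckerPow (unitTensor ℂ m) d))) ≠ 0) :=
  ⟨fun hm hK => uocc_four_row.1 hm (uocc_iff_kroneckerSemigroup_le.2 hK),
    fun hm => uocc_iff_kroneckerSemigroup_le.1 (uocc_four_row.2 hm)⟩

/-- **`K(n²,n²,n²) ⊄ S(⟨m⟩)` for `n ≥ 2`, `m ≤ n²+1`**: some triple with at most `n²` parts and positive Kronecker coefficient does not
occur in the powers of `⟨n²+1⟩` (Bürgisser–Ikenmeyer's `λₙ ∈ S(⟨n,n,n⟩) ∖ S(⟨n²+1⟩)`, tree `not_uocc_of_le_sq_add_one`), so the swallowing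
threshold is at least `n² + 2`. [cite: BurgisserIkenmeyer2011, Lemma 6.1] -/
theorem not_kroneckerSemigroup_le_of_le_sq_add_one {n m : ℕ} (hn : 2 ≤ n) (hm : m ≤ n ^ 2 + 1) :
    ¬ ∀ (d : ℕ) (lam : Fin 3 → Nat.Partition d), (∀ j, (lam j).parts.card ≤ n * n) →
      0 < kroneckerCoeff ℂ (lam 0) (lam 1) (lam 2) →
      isotypicSum₁ (lam 0) (isotypicSum₂ (lam 1) (isotypicSum₃ (lam 2) (kroneckerPow (unitTensor ℂ m) d))) ≠ 0 :=
  fun hK => not_uocc_of_le_sq_add_one n hn hm (uocc_iff_kroneckerSemigroup_le.2 hK)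

/-- **The format-`4` row at the SATURATION level: `Kron(4,4,4) = Δ(⟨4⟩)` (van den Berg et al. 2025, PROVED tree theorem
`vandenBergEtAl2025_unitTensor_four_polytope_maximal_holds`), transcribed to the Kronecker semigroup**: every triple `λ ⊢ n`, `n > 0`, with at
most `4` parts and positive Kronecker coefficient has a multiple `k·λ` (`k > 0`) occurring in `⟨4⟩^{⊗kn}` — although `λ` itself need not occur
even in `⟨5⟩^{⊗n}` (`kroneckerSemigroup_four_row`): the saturated swallowing threshold of format `4` is `4`, the honest one is `6` or `7`.
[cite: vandenBergChristandlLysikovNieuwboerWalterZuiddam2025, §1 after Cor. 1.5] [cite: BurgisserIkenmeyer2011, Lemma 6.1, Problem 8.3] -/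
theorem kroneckerSemigroup_four_saturated {n : ℕ} (hn : 0 < n) (lam : Fin 3 → Nat.Partition n)
    (hcard : ∀ j, (lam j).parts.card ≤ 4) (hg : 0 < kroneckerCoeff ℂ (lam 0) (lam 1) (lam 2)) :
    ∃ (k : ℕ) (mu : Fin 3 → Nat.Partition (k * n)), 0 < k ∧
      (∀ j, (mu j).parts = (lam j).parts.map (fun p => k * p)) ∧
        isotypicSum₁ (mu 0) (isotypicSum₂ (mu 1) (isotypicSum₃ (mu 2) (kroneckerPow (unitTensor ℂ 4) (k * n)))) ≠ 0 := by
  obtain ⟨s, hs⟩ := exists_occurs_of_kroneckerCoeff_pos hcard hg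
  exact vandenBergEtAl2025_unitTensor_four_polytope_maximal_holds (by simp) (by simp) (by simp) s n lam hn hs

/-! ## §4  Membership in `K(N,N,N)` and the generator criterion, transcribed -/

/-- **`λ ∈ K(N,N,N)` in both currencies**: a triple occurs in a tensor power of SOME complex tensor of format `N` iff each partition has at
most `N` parts and the Kronecker coefficient is positive (`exists_occurs_of_kroneckerCoeff_pos`; `kroneckerCoeff_pos_of_isotypicSum₁₂₃_kroneckerPow_ne_zero`,
`card_parts_le_of_isotypicSum₁₂₃_kroneckerPow_ne_zero`). [cite: BurgisserIkenmeyer2011, §3.2, Lemma 3.2 and (10.3)] -/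
theorem exists_occurs_iff_kronecker {N d : ℕ} (lam : Fin 3 → Nat.Partition d) :
    (∃ s : Fin N → Fin N → Fin N → ℂ, isotypicSum₁ (lam 0) (isotypicSum₂ (lam 1) (isotypicSum₃ (lam 2) (kroneckerPow s d))) ≠ 0) ↔
    (∀ j, (lam j).parts.card ≤ N) ∧ 0 < kroneckerCoeff ℂ (lam 0) (lam 1) (lam 2) := by
  classical
  refine ⟨fun ⟨s, hs⟩ => ⟨fun j => ?_, kroneckerCoeff_pos_of_isotypicSum₁₂₃_kroneckerPow_ne_zero hs⟩,
    fun ⟨hcard, hg⟩ => exists_occurs_of_kroneckerCoeff_pos hcard hg⟩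
  have hc := card_parts_le_of_isotypicSum₁₂₃_kroneckerPow_ne_zero hs
  simp only [Fintype.card_fin] at hc
  have h0 := hc.1
  have h1 := hc.2.1
  have h2 := hc.2.2
  fin_cases j <;> assumption

/-- **Generators of the Kronecker semigroup decide the swallowing** (`N ≤ m`): `K(N,N,N) ⊆ S(⟨m⟩)` iff every triple of degree `d > m` with at
most `N` parts and positive Kronecker coefficient EITHER occurs in `⟨m⟩^{⊗d}` OR is the row-wise sum of two such triples of positive degrees —
i.e. iff the indecomposable elements (Hilbert basis) of `K(N,N,N)` of degree `> m` lie in `S(⟨m⟩)`; degrees `≤ m` are automatic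
(`I(σ_m)_{≤m} = 0`).  So `u(N) ≤ max(N, D_K(N))`, `D_K(N)` the generation degree of the Kronecker semigroup — a bound in terms of Kronecker
coefficients alone (loose where secant filling decides: `u(3) = 5` while `K(3,3,3)` has indecomposables in every degree `≤ 14`, NODE-g32 §3).
(`uocc_iff_generators` of the companion through `exists_occurs_iff_kronecker`.) [cite: BurgisserIkenmeyer2011, §3.2, §10.4, Lemma 10.18] -/
theorem kroneckerSemigroup_le_iff_generators {m N : ℕ} (hNm : N ≤ m) :
    (∀ (d : ℕ) (lam : Fin 3 → Nat.Partition d), (∀ j, (lam j).parts.card ≤ N) →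
      0 < kroneckerCoeff ℂ (lam 0) (lam 1) (lam 2) →
      isotypicSum₁ (lam 0) (isotypicSum₂ (lam 1) (isotypicSum₃ (lam 2) (kroneckerPow (unitTensor ℂ m) d))) ≠ 0) ↔
    ∀ (d : ℕ) (lam : Fin 3 → Nat.Partition d), m < d →
      ((∀ j, (lam j).parts.card ≤ N) ∧ 0 < kroneckerCoeff ℂ (lam 0) (lam 1) (lam 2)) →
      isotypicSum₁ (lam 0) (isotypicSum₂ (lam 1) (isotypicSum₃ (lam 2) (kroneckerPow (unitTensor ℂ m) d))) ≠ 0 ∨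
      ∃ (d₁ d₂ : ℕ) (_ : d₁ + d₂ = d) (lam₁ : Fin 3 → Nat.Partition d₁) (lam₂ : Fin 3 → Nat.Partition d₂),
        0 < d₁ ∧ 0 < d₂ ∧
        ((∀ j, (lam₁ j).parts.card ≤ N) ∧ 0 < kroneckerCoeff ℂ (lam₁ 0) (lam₁ 1) (lam₁ 2)) ∧
        ((∀ j, (lam₂ j).parts.card ≤ N) ∧ 0 < kroneckerCoeff ℂ (lam₂ 0) (lam₂ 1) (lam₂ 2)) ∧
        ∀ j, (lam j).parts = ((lam₁ j).rowAdd (lam₂ j)).parts := by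
  rw [← uocc_iff_kroneckerSemigroup_le, uocc_iff_generators hNm]
  simp only [exists_occurs_iff_kronecker]

end Summit.MatrixMultiplication.MatrixMultiplication.Theorems.ObstructionCalculus

end
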